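import Literature.AlgebraicGeometry.Milne1999.SpecialLefschetzGroupInvariantsCMSimple
import Literature.AlgebraicGeometry.Pohlmann1968.DivisorClassesCMAlgebra
import Literature.AlgebraicGeometry.Motives.TateAbelianFiniteLatticeProofs
import Literature.AlgebraicGeometry.Motives.AbelianVarietyProductIsogeny
import HarnessLib

/-!
# The product polarization `Σᵢ πᵢ^* hᵢ` on a finite biproduct `⨁ᵢ Aᵢ` of complex abelian varieties
# (Milne 1999, Duke 96, §1 p. 643: "`D = Σᵢ A₁ × ⋯ × Dᵢ × ⋯ × A_s` is an ample divisor on `A`") — the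
# `n`-ary form of the tree's binary lemmas, read on `H¹`

Family `hodge`, layer `Literature/AlgebraicGeometry/Milne1999`, namespace
`Literature.AlgebraicGeometry.Milne1999` (D-0022). PROVED infrastructure (no named fact, no `sorry`;
D-0026): the two `def`s below (`biproductSuccSplit`, `sumPolarizationClass`) have bodies.  Written for the
cell `pub-hodgecm2` (COR-CM), seat `lit-milne`, binder table `HOME/lit/milne.md` rows M2/M4, as the input of
`Milne1999/SpecialLefschetzGroupInvariantsCMProducts` (Milne's Thm. 3.2 / Lemma 3.8 in the torus case with
multiplicities, on biproducts of CM realisations).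

## Source, verbatim

J. S. Milne, *Lefschetz classes on abelian varieties*, Duke Math. J. 96 (1999) 639–675
[`paper:doi-10-1215-s0012-7094-99-09620-5`, held; PDF page = printed page − 638], §1 p. 643
(p0005 L12–L24): "For any positive integer `r`, `V(A^r) = rV(A)`, and the diagonal action of `C(A)` on
`rV(A)` identifies `C(A)` with `C(A^r)` (as `k`-algebras with involution). Let `A = A₁ × ⋯ × A_s`. Then
`C(A) ⊂ C(A₁) × ⋯ × C(A_s)`, with equality holding if and only if `Hom(Aᵢ, Aⱼ) = 0` for all `i, j`,
`i ≠ j`. Moreover, if `Dᵢ` is an ample divisor on `Aᵢ`, `i = 1, …, s`, then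
`D = Σᵢ A₁ × ⋯ × A_{i-1} × Dᵢ × A_{i+1} × ⋯ × A_s` is an ample divisor on `A`, and the involution it
defines on `C(A)` is the restriction of the product of the involutions on the `C(Aᵢ)` defined by the
`Dᵢ`."

## What is here (the tree's carriers: `ℂ`-points, Betti cohomology, read on `H¹`)

The binary case `A × B` (`Motives.AbelianVariety.prod`, class `prodPolarizationClass`) is the tree's
`Milne1999/LefschetzGroupProducts` (block form of `Q_D`) and `Milne1999/SpecialLefschetzGroupOneEqUnitaryCentralizer`
§3 (`B¹`-membership, top power, non-degeneracy).  This file passes to the FINITE BIPRODUCT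
`⨁_{i : Fin n} Aᵢ` (Mathlib's `biproduct`, the carrier of the tree's Pohlmann CM-algebra files
`Pohlmann1968/HodgeClassesCMAlgebra`, `Pohlmann1968/DivisorClassesCMAlgebra`) by induction along the
comparison isomorphism `⨁_{Fin (n+1)} A ≅ A 0 × ⨁_{Fin n} (A ∘ succ)`:

* `biproductSuccSplit A` (a `def`: `(π₀, (π_{i+1})ᵢ)`) with its inverse, an isogeny
  (`isIsogeny_biproductSuccSplit`), its naturality and its action on pulled-back classes;
  `dim_biproduct_succ`; `isIsogeny_biproduct_map` (a componentwise isogeny of biproducts is an isogeny).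
* `sumPolarizationClass A h = Σᵢ πᵢ^* hᵢ` (a `def`: the class of Milne's `D`), and
  `map_biproductSuccSplit_prodPolarizationClass`: it is the pull-back of the binary product class.
* **`sumPolarizationClass_hypotheses`**: if every `hᵢ ∈ B¹(Aᵢ) ⊗ ℂ` has `hᵢ^{dim Aᵢ} ≠ 0` and a
  non-degenerate `Q_{hᵢ}` on `H¹(Aᵢ)` (`0 < dim Aᵢ`), then `Σ πᵢ^* hᵢ ∈ B¹(⨁ A) ⊗ ℂ`, its top power is
  `≠ 0`, and `Q_{Σ πᵢ^* hᵢ}` is non-degenerate on `H¹(⨁ A)` — the three hypotheses of the tree's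
  `exteriorPullbackEquiv_mem_specialLefschetzGroup` (Thm. 4.4: `S(A)(ℂ) ↪ ker l(A)`).
* **Block form of `Q_D` on `H¹(⨁ A) = ⊕ᵢ πᵢ^* H¹(Aᵢ)`** ("the involution it defines on `C(A)` is the
  restriction of the product of the involutions"): `polarizationPairingOne_sum_map_π_map_π_of_ne` — the
  mixed blocks vanish, `Q_D(πᵢ^* a, πⱼ^* b) = 0` for `i ≠ j`; `polarizationPairingOne_sum_map_π_map_π_eq_zero`
  — the diagonal block is controlled by the factor, `Q_{hᵢ}(a, b) = 0 ⟹ Q_D(πᵢ^* a, πᵢ^* b) = 0`.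
* `polarizationPairingOne_apply_apply_eq_of_basis` — linear algebra: an automorphism diagonal on a basis
  `w` of `H¹`, with `d_y d_{y'} = 1` whenever `Q(w_y, w_{y'}) ≠ 0`, preserves `Q`.

## References

* [Milne1999LefschetzClasses] J. S. Milne, Lefschetz classes on abelian varieties, Duke Math. J. 96 (1999)
  639–675, §1 p. 643 (products and the divisor `D`), Prop. 1.1, Thm. 4.4 (p. 659).
* [LangeBirkenhake1992] H. Lange, Ch. Birkenhake, Complex Abelian Varieties, §5.3 (products of polarized
  abelian varieties).
* [HatcherAT2002] A. Hatcher, Algebraic Topology, §3.2 Thm. 3.16 (Künneth), Prop. 3.10.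
* [MumfordAV1970] D. Mumford, Abelian Varieties, §19 (products, isogenies).
-/

noncomputable section

open CategoryTheory CategoryTheory.Limits
open Literature.AlgebraicTopology.SingularHomology
open Literature.AlgebraicGeometry.HodgeTheory
open Literature.AlgebraicGeometry.Motives
open Literature.AlgebraicGeometry.VanGeemen1994 (hodgeClassSpan)
open Literature.Geometry.Kaehler (lefschetzPow)

namespace Literature.AlgebraicGeometry.Milne1999

/-! ### §1 The comparison isomorphism `⨁_{Fin (n+1)} A ≅ A 0 × ⨁_{Fin n} (A ∘ succ)` -/

section Split

variable {n : ℕ} (A : Fin (n + 1) → AbelianVariety ℂ)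

/-- **The comparison morphism `(π₀, (π_{i+1})ᵢ) : ⨁_{i < n+1} Aᵢ ⟶ A₀ × ⨁_{i < n} A_{i+1}`** (universal
properties of the biproduct and of the tree's product `AbelianVariety.prod`); an isomorphism
(`biproductSuccSplit_comp_inv`, `biproductSuccSplitInv_comp`), Milne's "`A = A₁ × ⋯ × A_s`" read one factor
at a time. A `def` with a body. [cite: Milne1999LefschetzClasses, §1 p. 643] [cite: MumfordAV1970, §19] -/
def biproductSuccSplit : (⨁ A) ⟶ (A 0).prod (⨁ fun i : Fin n => A i.succ) :=
  AbelianVariety.prodLift (biproduct.π A 0) (biproduct.lift fun i : Fin n => biproduct.π A i.succ)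

/-- The inverse comparison morphism `A₀ × ⨁_{i < n} A_{i+1} ⟶ ⨁_{i < n+1} Aᵢ` (components `pr₁` and
`pr₂ ≫ πᵢ`). A `def` with a body. [cite: Milne1999LefschetzClasses, §1 p. 643] [cite: MumfordAV1970, §19] -/
def biproductSuccSplitInv : (A 0).prod (⨁ fun i : Fin n => A i.succ) ⟶ ⨁ A :=
  biproduct.lift fun j => Fin.cases (AbelianVariety.fst _ _)
    (fun i : Fin n => AbelianVariety.snd _ _ ≫ biproduct.π (fun i : Fin n => A i.succ) i) j

/-- `biproductSuccSplit ≫ biproductSuccSplitInv = 𝟙`. [cite: MumfordAV1970, §19] -/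
theorem biproductSuccSplit_comp_inv : biproductSuccSplit A ≫ biproductSuccSplitInv A = 𝟙 (⨁ A) := by
  unfold biproductSuccSplit biproductSuccSplitInv
  refine biproduct.hom_ext _ _ fun j => ?_
  rw [Category.assoc, biproduct.lift_π, Category.id_comp]
  refine Fin.cases ?_ (fun i => ?_) j
  · exact AbelianVariety.prodLift_fst _ _
  · change AbelianVariety.prodLift _ _ ≫ AbelianVariety.snd _ _ ≫ biproduct.π (fun i : Fin n => A i.succ) i =
      biproduct.π A i.succ
    rw [← Category.assoc, AbelianVariety.prodLift_snd, biproduct.lift_π]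

/-- `biproductSuccSplitInv ≫ biproductSuccSplit = 𝟙`. [cite: MumfordAV1970, §19] -/
theorem biproductSuccSplitInv_comp :
    biproductSuccSplitInv A ≫ biproductSuccSplit A = 𝟙 ((A 0).prod (⨁ fun i : Fin n => A i.succ)) := by
  unfold biproductSuccSplit biproductSuccSplitInv
  refine AbelianVariety.prod_hom_ext ?_ ?_
  · rw [Category.assoc, AbelianVariety.prodLift_fst, biproduct.lift_π, Category.id_comp]
    rfl
  · rw [Category.assoc, AbelianVariety.prodLift_snd, Category.id_comp]
    refine biproduct.hom_ext _ _ fun i => ?_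
    rw [Category.assoc, biproduct.lift_π, biproduct.lift_π]
    rfl

/-- **The comparison morphism is an isogeny** (an isomorphism: both composites with its inverse are
identities). [cite: MumfordAV1970, §19] -/
theorem isIsogeny_biproductSuccSplit : AbelianVariety.IsIsogeny (biproductSuccSplit A) :=
  AbelianVariety.isIsogeny_of_comp_eq_of_comp_eq (AbelianVariety.isIsogeny_id _)
    (AbelianVariety.isIsogeny_id _) (biproductSuccSplitInv_comp A) (biproductSuccSplit_comp_inv A)

/-- `(π₀, (π_{i+1})ᵢ) ≫ pr₁ = π₀`. [cite: MumfordAV1970, §19] -/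
theorem biproductSuccSplit_fst : biproductSuccSplit A ≫ AbelianVariety.fst _ _ = biproduct.π A 0 :=
  AbelianVariety.prodLift_fst _ _

/-- `(π₀, (π_{i+1})ᵢ) ≫ pr₂ ≫ πᵢ = π_{i+1}`. [cite: MumfordAV1970, §19] -/
theorem biproductSuccSplit_snd_π (i : Fin n) :
    biproductSuccSplit A ≫ AbelianVariety.snd _ _ ≫ biproduct.π (fun i : Fin n => A i.succ) i =
      biproduct.π A i.succ := by
  unfold biproductSuccSplit
  rw [← Category.assoc, AbelianVariety.prodLift_snd, biproduct.lift_π]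

/-- On cohomology: `(π₀, (π_{i+1})ᵢ)^* (pr₁^* x) = π₀^* x`. [cite: HatcherAT2002, §3.2 Prop. 3.10] -/
theorem map_biproductSuccSplit_map_fst {k : ℕ} (x : complexBetti (A 0).X k) :
    complexBetti.map (biproductSuccSplit A).hom.hom.hom k
        (complexBetti.map (AbelianVariety.fst (A 0) (⨁ fun i : Fin n => A i.succ)).hom.hom.hom k x) =
      complexBetti.map (biproduct.π A 0).hom.hom.hom k x := by
  rw [← complexBetti_map_comp_apply, biproductSuccSplit_fst]

/-- On cohomology: `(π₀, (π_{i+1})ᵢ)^* (pr₂^* (πᵢ^* x)) = π_{i+1}^* x`. [cite: HatcherAT2002, §3.2 Prop. 3.10] -/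
theorem map_biproductSuccSplit_map_snd_map_π {k : ℕ} (i : Fin n) (x : complexBetti (A i.succ).X k) :
    complexBetti.map (biproductSuccSplit A).hom.hom.hom k
        (complexBetti.map (AbelianVariety.snd (A 0) (⨁ fun i : Fin n => A i.succ)).hom.hom.hom k
          (complexBetti.map (biproduct.π (fun i : Fin n => A i.succ) i).hom.hom.hom k x)) =
      complexBetti.map (biproduct.π A i.succ).hom.hom.hom k x := by
  rw [← complexBetti_map_comp_apply, ← complexBetti_map_comp_apply, Category.assoc, biproductSuccSplit_snd_π]

/-- **`dim (⨁_{i<n+1} Aᵢ) = dim A₀ + dim (⨁_{i<n} A_{i+1})`** (isogenies preserve the dimension;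
`dim (A × B) = dim A + dim B`). [cite: MumfordAV1970, §19] -/
theorem dim_biproduct_succ : (⨁ A).dim = (A 0).dim + (⨁ fun i : Fin n => A i.succ).dim := by
  rw [AbelianVariety.dim_eq_of_isIsogeny (isIsogeny_biproductSuccSplit A), AbelianVariety.dim_prod]

/-- `0 < dim (⨁_{i<n+1} Aᵢ)` as soon as `0 < dim A₀`. [cite: MumfordAV1970, §19] -/
theorem dim_biproduct_pos (h0 : 0 < (A 0).dim) : 0 < (⨁ A).dim := by
  rw [dim_biproduct_succ]; omega

/-- The inverse comparison morphism is an isogeny as well. [cite: MumfordAV1970, §19] -/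
theorem isIsogeny_biproductSuccSplitInv : AbelianVariety.IsIsogeny (biproductSuccSplitInv A) :=
  AbelianVariety.isIsogeny_of_comp_eq_of_comp_eq (AbelianVariety.isIsogeny_id _)
    (AbelianVariety.isIsogeny_id _) (biproductSuccSplit_comp_inv A) (biproductSuccSplitInv_comp A)

/-- `π₀ ≫ ι₀ = 𝟙` on `⨁_{Fin 1} A`. [cite: MumfordAV1970, §19] -/
theorem biproduct_π_ι_fin_one (A : Fin 1 → AbelianVariety ℂ) :
    biproduct.π A 0 ≫ biproduct.ι A 0 = 𝟙 (⨁ A) := by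
  refine biproduct.hom_ext _ _ fun j => ?_
  rw [Fin.fin_one_eq_zero j, Category.assoc, biproduct.ι_π_self, Category.comp_id, Category.id_comp]

/-- **`π₀ : ⨁_{Fin 1} A ⟶ A 0` is an isogeny** (an isomorphism with inverse `ι₀`). [cite: MumfordAV1970, §19] -/
theorem isIsogeny_biproduct_π_fin_one (A : Fin 1 → AbelianVariety ℂ) :
    AbelianVariety.IsIsogeny (biproduct.π A 0) :=
  AbelianVariety.isIsogeny_of_comp_eq_of_comp_eq (h := biproduct.ι A 0)
    (AbelianVariety.isIsogeny_id _) (AbelianVariety.isIsogeny_id _) (biproduct.ι_π_self A 0)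
    (biproduct_π_ι_fin_one A)

/-- `ι₀ : A 0 ⟶ ⨁_{Fin 1} A` is an isogeny (an isomorphism with inverse `π₀`). [cite: MumfordAV1970, §19] -/
theorem isIsogeny_biproduct_ι_fin_one (A : Fin 1 → AbelianVariety ℂ) :
    AbelianVariety.IsIsogeny (biproduct.ι A 0) :=
  AbelianVariety.isIsogeny_of_comp_eq_of_comp_eq (h := biproduct.π A 0)
    (AbelianVariety.isIsogeny_id _) (AbelianVariety.isIsogeny_id _) (biproduct_π_ι_fin_one A)
    (biproduct.ι_π_self A 0)

/-- **Naturality of the comparison morphism**: `(⊕ᵢ gᵢ) ≫ (π₀, (π_{i+1})ᵢ) = (π₀, (π_{i+1})ᵢ) ≫ (g₀ × ⊕ᵢ g_{i+1})`.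
[cite: MumfordAV1970, §19] -/
theorem biproduct_map_comp_biproductSuccSplit {B : Fin (n + 1) → AbelianVariety ℂ} (g : ∀ i, A i ⟶ B i) :
    biproduct.map g ≫ biproductSuccSplit B =
      biproductSuccSplit A ≫ AbelianVariety.prodMap (g 0) (biproduct.map fun i : Fin n => g i.succ) := by
  unfold biproductSuccSplit
  refine AbelianVariety.prod_hom_ext ?_ ?_
  · rw [Category.assoc, AbelianVariety.prodLift_fst, biproduct.map_π, Category.assoc, AbelianVariety.prodMap_fst,
      ← Category.assoc, AbelianVariety.prodLift_fst]
  · rw [Category.assoc, AbelianVariety.prodLift_snd, Category.assoc, AbelianVariety.prodMap_snd,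
      ← Category.assoc, AbelianVariety.prodLift_snd]
    refine biproduct.hom_ext _ _ fun i => ?_
    rw [Category.assoc, biproduct.lift_π, biproduct.map_π, Category.assoc, biproduct.map_π, ← Category.assoc,
      biproduct.lift_π]

/-- **A componentwise isogeny `⊕ᵢ gᵢ : ⨁ Aᵢ ⟶ ⨁ Bᵢ` of finite biproducts is an isogeny** (products of
isogenies are isogenies, Mumford §19; by induction along the comparison isomorphisms, from the tree's binary
`AbelianVariety.isIsogeny_prodMap`). [cite: MumfordAV1970, §19] [cite: Milne1986AbelianVarieties, §12 p. 122] -/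
theorem isIsogeny_biproduct_map : ∀ {n : ℕ} {A B : Fin (n + 1) → AbelianVariety ℂ} {g : ∀ i, A i ⟶ B i},
    (∀ i, AbelianVariety.IsIsogeny (g i)) → AbelianVariety.IsIsogeny (biproduct.map g)
  | 0, A, B, g, hg => by
    have e : biproduct.map g = biproduct.π A 0 ≫ g 0 ≫ biproduct.ι B 0 := by
      refine biproduct.hom_ext _ _ fun j => ?_
      rw [Fin.fin_one_eq_zero j, biproduct.map_π, Category.assoc, Category.assoc, biproduct.ι_π_self,
        Category.comp_id]
    rw [e]
    exact AbelianVariety.isIsogeny_comp (isIsogeny_biproduct_π_fin_one A)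
      (AbelianVariety.isIsogeny_comp (hg 0) (isIsogeny_biproduct_ι_fin_one B))
  | n + 1, A, B, g, hg => by
    have e : biproduct.map g = biproductSuccSplit A ≫
        AbelianVariety.prodMap (g 0) (biproduct.map fun i : Fin (n + 1) => g i.succ) ≫ biproductSuccSplitInv B := by
      rw [← Category.assoc, ← biproduct_map_comp_biproductSuccSplit, Category.assoc, biproductSuccSplit_comp_inv,
        Category.comp_id]
    rw [e]
    exact AbelianVariety.isIsogeny_comp (isIsogeny_biproductSuccSplit A)
      (AbelianVariety.isIsogeny_comp
        (AbelianVariety.isIsogeny_prodMap (hg 0) (isIsogeny_biproduct_map fun i => hg i.succ))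
        (isIsogeny_biproductSuccSplitInv B))

end Split

/-! ### §2 Milne's product divisor: the class `Σᵢ πᵢ^* hᵢ` -/

section SumClass

variable {m : ℕ}

/-- **The product polarization class `Σᵢ πᵢ^* hᵢ ∈ H²((⨁ Aᵢ)(ℂ); ℂ)`** of classes
`hᵢ ∈ H²(Aᵢ(ℂ); ℂ)` — the class of Milne's ample divisor "`D = Σᵢ A₁ × ⋯ × A_{i-1} × Dᵢ × A_{i+1} × ⋯ × A_s`"
(§1 p. 643) on the finite biproduct; the `n`-ary form of the tree's `prodPolarizationClass`. A `def` with
a body. [cite: Milne1999LefschetzClasses, §1 p. 643] [cite: LangeBirkenhake1992, §5.3] -/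
def sumPolarizationClass (A : Fin m → AbelianVariety ℂ) (h : ∀ i, complexBetti (A i).X 2) :
    complexBetti (⨁ A).X 2 :=
  ∑ i, complexBetti.map (biproduct.π A i).hom.hom.hom 2 (h i)

/-- Unfolding of `sumPolarizationClass`. [cite: Milne1999LefschetzClasses, §1 p. 643] -/
theorem sumPolarizationClass_def (A : Fin m → AbelianVariety ℂ) (h : ∀ i, complexBetti (A i).X 2) :
    sumPolarizationClass A h = ∑ i, complexBetti.map (biproduct.π A i).hom.hom.hom 2 (h i) := rfl

/-- On one factor the product class is `π₀^* h₀`. [cite: Milne1999LefschetzClasses, §1 p. 643] -/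
theorem sumPolarizationClass_fin_one (A : Fin 1 → AbelianVariety ℂ) (h : ∀ i, complexBetti (A i).X 2) :
    sumPolarizationClass A h = complexBetti.map (biproduct.π A 0).hom.hom.hom 2 (h 0) := by
  rw [sumPolarizationClass_def, Fin.sum_univ_one]

variable {n : ℕ} (A : Fin (n + 1) → AbelianVariety ℂ) (h : ∀ i, complexBetti (A i).X 2)

/-- **`Σᵢ πᵢ^* hᵢ` is the pull-back of the binary product class** `pr₁^* h₀ + pr₂^* (Σᵢ πᵢ^* h_{i+1})` along
the comparison isomorphism `⨁_{Fin (n+1)} A ≅ A 0 × ⨁_{Fin n} (A ∘ succ)` (Milne's `D` one factor at a time).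
[cite: Milne1999LefschetzClasses, §1 p. 643] -/
theorem map_biproductSuccSplit_prodPolarizationClass :
    complexBetti.map (biproductSuccSplit A).hom.hom.hom 2
        (prodPolarizationClass (A 0) (⨁ fun i : Fin n => A i.succ) (h 0)
          (sumPolarizationClass (fun i : Fin n => A i.succ) fun i => h i.succ)) =
      sumPolarizationClass A h := by
  rw [prodPolarizationClass_def, map_add, map_biproductSuccSplit_map_fst, sumPolarizationClass_def,
    sumPolarizationClass_def, map_sum, map_sum, Fin.sum_univ_succ]
  congr 1
  exact Finset.sum_congr rfl fun i _ => map_biproductSuccSplit_map_snd_map_π A i (h i.succ)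

end SumClass

/-! ### §3 `Σ πᵢ^* hᵢ ∈ B¹ ⊗ ℂ`, its top power, and the non-degeneracy of `Q_D` on `H¹(⨁ A)` -/

section Hypotheses

/-- **The three polarization hypotheses for Milne's product divisor on `⨁_{i<n+1} Aᵢ`**: if every
`hᵢ` lies in `B¹(Aᵢ) ⊗ ℂ`, has `hᵢ^{dim Aᵢ} ≠ 0` and a non-degenerate pairing `Q_{hᵢ}` on `H¹(Aᵢ)`
(`0 < dim Aᵢ`), then `D = Σᵢ πᵢ^* hᵢ` lies in `B¹(⨁ A) ⊗ ℂ`, `D^{dim ⨁ A} ≠ 0`, and `Q_D` is non-degenerate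
on `H¹(⨁ A)` ("`D` is an ample divisor on `A`", §1 p. 643 — here only these three consequences, by
induction along `⨁_{Fin (n+1)} A ≅ A 0 × ⨁_{Fin n} (A ∘ succ)` from the tree's binary lemmas
`prodPolarizationClass_mem_hodgeClassSpan`, `lefschetzPow_prodPolarizationClass_self_ne_zero`,
`eq_zero_of_forall_polarizationPairingOne_prod_eq_zero`, transported by `polarization_hypotheses_map`).
[cite: Milne1999LefschetzClasses, §1 p. 643] [cite: LangeBirkenhake1992, §5.3] -/
theorem sumPolarizationClass_hypotheses : ∀ {n : ℕ} (A : Fin (n + 1) → AbelianVariety ℂ)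
    (h : ∀ i, complexBetti (A i).X 2), (∀ i, 0 < (A i).dim) →
    (∀ i, h i ∈ hodgeClassSpan (A i).dim (A i).X 1) →
    (∀ i, lefschetzPow (h i) ((A i).dim - 1) 2 (h i) ≠ 0) →
    (∀ (i) (x : complexBetti (A i).X 1),
      (∀ y, polarizationPairingOne (A i).X (h i) ((A i).dim - 1) x y = 0) → x = 0) →
    sumPolarizationClass A h ∈ hodgeClassSpan (⨁ A).dim (⨁ A).X 1 ∧
      lefschetzPow (sumPolarizationClass A h) ((⨁ A).dim - 1) 2 (sumPolarizationClass A h) ≠ 0 ∧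
      ∀ x : complexBetti (⨁ A).X 1,
        (∀ y, polarizationPairingOne (⨁ A).X (sumPolarizationClass A h) ((⨁ A).dim - 1) x y = 0) → x = 0
  | 0, A, h, _, hh, htop, hnd => by
    rw [sumPolarizationClass_fin_one]
    exact polarization_hypotheses_map (isIsogeny_biproduct_π_fin_one A) (hh 0) (htop 0) (hnd 0)
  | n + 1, A, h, h0, hh, htop, hnd => by
    obtain ⟨hh', htop', hnd'⟩ := sumPolarizationClass_hypotheses (fun i : Fin (n + 1) => A i.succ)
      (fun i => h i.succ) (fun i => h0 _) (fun i => hh _) (fun i => htop _) (fun i => hnd _)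
    have hB0 : 0 < (A 0).dim := h0 0
    have hC0 : 0 < (⨁ fun i : Fin (n + 1) => A i.succ).dim := dim_biproduct_pos _ (h0 _)
    have H := polarization_hypotheses_map (isIsogeny_biproductSuccSplit A)
      (prodPolarizationClass_mem_hodgeClassSpan _ _ (hh 0) hh')
      (lefschetzPow_prodPolarizationClass_self_ne_zero _ _ hB0 hC0 (htop 0) htop')
      (eq_zero_of_forall_polarizationPairingOne_prod_eq_zero _ _ hB0 hC0 (htop 0) htop' (hnd 0) hnd')
    rwa [map_biproductSuccSplit_prodPolarizationClass] at H

end Hypotheses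

/-! ### §4 The block form of `Q_D` on `H¹(⨁ A) = ⊕ᵢ πᵢ^* H¹(Aᵢ)` -/

section Blocks

/-- **The mixed blocks of `Q_D` vanish**: for `i ≠ j`, `a ∈ H¹(Aᵢ)`, `b ∈ H¹(Aⱼ)`,
`Q_D(πᵢ^* a, πⱼ^* b) = 0` for `D = Σ πᵢ^* hᵢ` ("the involution it defines on `C(A)` is the restriction of
the product of the involutions on the `C(Aᵢ)`", §1 p. 643; the binary `polarizationPairingOne_prod_map_fst_map_snd`
iterated along `⨁_{Fin (n+1)} A ≅ A 0 × ⨁_{Fin n} (A ∘ succ)`).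
[cite: Milne1999LefschetzClasses, §1 p. 643] [cite: LangeBirkenhake1992, §5.3] -/
theorem polarizationPairingOne_sum_map_π_map_π_of_ne : ∀ {n : ℕ} (A : Fin (n + 1) → AbelianVariety ℂ)
    (h : ∀ i, complexBetti (A i).X 2), (∀ i, 0 < (A i).dim) → ∀ {i j : Fin (n + 1)}, i ≠ j →
    ∀ (a : complexBetti (A i).X 1) (b : complexBetti (A j).X 1),
      polarizationPairingOne (⨁ A).X (sumPolarizationClass A h) ((⨁ A).dim - 1)
        (complexBetti.map (biproduct.π A i).hom.hom.hom 1 a)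
        (complexBetti.map (biproduct.π A j).hom.hom.hom 1 b) = 0
  | 0, A, h, _, i, j, hij, a, b =>
    absurd ((Fin.fin_one_eq_zero i).trans (Fin.fin_one_eq_zero j).symm) hij
  | n + 1, A, h, h0, i, j, hij, a, b => by
    have hB0 : 0 < (A 0).dim := h0 0
    have hC0 : 0 < (⨁ fun i : Fin (n + 1) => A i.succ).dim := dim_biproduct_pos _ (h0 _)
    have hd : (⨁ A).dim - 1 = ((A 0).prod (⨁ fun i : Fin (n + 1) => A i.succ)).dim - 1 := by
      rw [AbelianVariety.dim_eq_of_isIsogeny (isIsogeny_biproductSuccSplit A)]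
    rw [hd, ← map_biproductSuccSplit_prodPolarizationClass]
    revert hij a b
    refine Fin.cases ?_ (fun i' => ?_) i <;> refine Fin.cases ?_ (fun j' => ?_) j
    · intro hij; exact absurd rfl hij
    · intro _ a b
      rw [← map_biproductSuccSplit_map_fst A a, ← map_biproductSuccSplit_map_snd_map_π A j' b,
        ← map_polarizationPairingOne, polarizationPairingOne_prod_map_fst_map_snd _ _ hB0 hC0, map_zero]
    · intro _ a b
      rw [← map_biproductSuccSplit_map_fst A b, ← map_biproductSuccSplit_map_snd_map_π A i' a,
        ← map_polarizationPairingOne, polarizationPairingOne_prod_map_snd_map_fst _ _ hB0 hC0, map_zero]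
    · intro hij a b
      have hij' : i' ≠ j' := fun e => hij (by rw [e])
      rw [← map_biproductSuccSplit_map_snd_map_π A i' a, ← map_biproductSuccSplit_map_snd_map_π A j' b,
        ← map_polarizationPairingOne, polarizationPairingOne_prod_map_snd_map_snd _ _ hB0 hC0,
        polarizationPairingOne_sum_map_π_map_π_of_ne (fun i : Fin (n + 1) => A i.succ) (fun i => h i.succ)
          (fun i => h0 _) hij' a b, map_zero, map_zero, smul_zero, map_zero]

/-- **The diagonal blocks of `Q_D` are controlled by the factors**: if `Q_{hᵢ}(a, b) = 0` on `Aᵢ` then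
`Q_D(πᵢ^* a, πᵢ^* b) = 0` on `⨁ A` (`D = Σ πᵢ^* hᵢ`; binary case: `Q_D(pr_A^* a, pr_A^* a') =
C · pr_A^*(Q_{D_A}(a, a')) ⌣ pr_B^*(h_B^{dim B})`, the tree's `polarizationPairingOne_prod_map_fst_map_fst`).
[cite: Milne1999LefschetzClasses, §1 p. 643] [cite: LangeBirkenhake1992, §5.3] -/
theorem polarizationPairingOne_sum_map_π_map_π_eq_zero : ∀ {n : ℕ} (A : Fin (n + 1) → AbelianVariety ℂ)
    (h : ∀ i, complexBetti (A i).X 2), (∀ i, 0 < (A i).dim) → ∀ (i : Fin (n + 1))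
    (a b : complexBetti (A i).X 1), polarizationPairingOne (A i).X (h i) ((A i).dim - 1) a b = 0 →
      polarizationPairingOne (⨁ A).X (sumPolarizationClass A h) ((⨁ A).dim - 1)
        (complexBetti.map (biproduct.π A i).hom.hom.hom 1 a)
        (complexBetti.map (biproduct.π A i).hom.hom.hom 1 b) = 0
  | 0, A, h, _, i, a, b, hab => by
    have hi : i = 0 := Fin.fin_one_eq_zero i
    subst hi
    have hd : (⨁ A).dim - 1 = (A 0).dim - 1 := by
      rw [AbelianVariety.dim_eq_of_isIsogeny (isIsogeny_biproduct_π_fin_one A)]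
    rw [hd, sumPolarizationClass_fin_one, ← map_polarizationPairingOne, hab, map_zero]
  | n + 1, A, h, h0, i, a, b, hab => by
    have hB0 : 0 < (A 0).dim := h0 0
    have hC0 : 0 < (⨁ fun i : Fin (n + 1) => A i.succ).dim := dim_biproduct_pos _ (h0 _)
    have hd : (⨁ A).dim - 1 = ((A 0).prod (⨁ fun i : Fin (n + 1) => A i.succ)).dim - 1 := by
      rw [AbelianVariety.dim_eq_of_isIsogeny (isIsogeny_biproductSuccSplit A)]
    rw [hd, ← map_biproductSuccSplit_prodPolarizationClass]
    revert a b
    refine Fin.cases ?_ (fun i' => ?_) i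
    · intro a b hab
      rw [← map_biproductSuccSplit_map_fst A a, ← map_biproductSuccSplit_map_fst A b,
        ← map_polarizationPairingOne, polarizationPairingOne_prod_map_fst_map_fst _ _ hB0 hC0, hab, map_zero,
        map_zero, LinearMap.zero_apply, smul_zero, map_zero]
    · intro a b hab
      rw [← map_biproductSuccSplit_map_snd_map_π A i' a, ← map_biproductSuccSplit_map_snd_map_π A i' b,
        ← map_polarizationPairingOne, polarizationPairingOne_prod_map_snd_map_snd _ _ hB0 hC0,
        polarizationPairingOne_sum_map_π_map_π_eq_zero (fun i : Fin (n + 1) => A i.succ) (fun i => h i.succ)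
          (fun i => h0 _) i' a b hab, map_zero, map_zero, smul_zero, map_zero]

end Blocks

/-! ### §5 Linear algebra: automorphisms diagonal on a basis of `H¹` adapted to `Q` -/

section Diagonal

variable {X : AbelianVariety ℂ} {h : complexBetti X.X 2} {j : ℕ} {I : Type*}

/-- **A diagonal automorphism with `d_y d_{y'} = 1` on every non-orthogonal pair of basis vectors
preserves the polarization pairing**: if `u (w_y) = d_y w_y` on a basis `w` of `H¹(X(ℂ); ℂ)` and
`d_y d_{y'} = 1` whenever `Q_h(w_y, w_{y'}) ≠ 0`, then `Q_h(u x, u z) = Q_h(x, z)` for all `x, z`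
(bilinearity; Milne §1 p. 645: on `C₀(A) ⊗ ℝ` a Rosati involution "acts as complex conjugation", so
`γ†γ = 1` reads `d_σ d_σ̄ = 1` on eigenlines). [cite: Milne1999LefschetzClasses, §1 pp. 644–645]
[cite: Milne1999, §2 Prop. 2.5 (proof)] -/
theorem polarizationPairingOne_apply_apply_eq_of_basis (w : Module.Basis I ℂ (complexBetti X.X 1))
    {u : complexBetti X.X 1 →ₗ[ℂ] complexBetti X.X 1} {d : I → ℂ} (hu : ∀ y, u (w y) = d y • w y)
    (hQ : ∀ y y', polarizationPairingOne X.X h j (w y) (w y') ≠ 0 → d y * d y' = 1)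
    (x z : complexBetti X.X 1) :
    polarizationPairingOne X.X h j (u x) (u z) = polarizationPairingOne X.X h j x z := by
  have key : ∀ y y', polarizationPairingOne X.X h j (u (w y)) (u (w y')) =
      polarizationPairingOne X.X h j (w y) (w y') := by
    intro y y'
    rw [hu, hu, LinearMap.map_smul₂, map_smul, smul_smul]
    by_cases h0 : polarizationPairingOne X.X h j (w y) (w y') = 0
    · rw [h0, smul_zero]
    · rw [hQ y y' h0, one_smul]
  have hB : (polarizationPairingOne X.X h j).compl₁₂ u u = polarizationPairingOne X.X h j :=
    w.ext fun y => w.ext fun y' => by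
      rw [LinearMap.compl₁₂_apply]
      exact key y y'
  have e := LinearMap.congr_fun₂ hB x z
  rwa [LinearMap.compl₁₂_apply] at e

end Diagonal

end Literature.AlgebraicGeometry.Milne1999

end
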